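import Literature.NumberTheory.GaloisRepresentations.LocalBrauerInvariantTransport
import HarnessLib

/-!
# The invariant `inv_{L/K}` of an abstract layer is preserved by isomorphisms of the BASE local field:
# `inv_{L₂/K₂} ∘ H²(θ_L⁻¹ · θ_L, θ_L) = inv_{L₁/K₁}` for `θ : K₁ ⥲ K₂` and `θ_L : L₁ ⥲ L₂` over `θ`
# (Serre, *Local Fields* XI §1 (iv); Tate, C–F VII §1.1: `σ_w : L_w ⥲ L_{σw}` "trivially preserves the invariant map")

Topic `NumberTheory/GaloisRepresentations` (local class field theory); namespace
`Literature.NumberTheory.GaloisRepresentations.UnitsLayer` (door-c6's `layerInv`, `LocalCanonicalFundamentalClassAbstract`).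
Definitions with bodies (the transport) and theorems; NO named fact, no `sorry`, no instance, no notation.  Lane
«TATE-EPC-TC» of cell `bsd-eis` (crux `GoodLatticeBDPValue`, stmt-BirchSwinnertonDyer-19032), piece (θ-ii), file 2/2;
sequel to `LocalBrauerInvariantTransport.lean` (`LocalBrauer.brauerTransport`, `brauerInvariantEquiv_brauerTransport`).

Mathematics.  `UnitsLayer.layerInv K L = inv_K ∘ unitsAbsInfTwo K L` (`layerInv_eq_brauerInvariantEquiv_unitsAbsInfTwo`).
The tree proves invariance of `layerInv` under `K`-ISOMORPHISMS `L ≃ₐ[K] L'` (`IdeleLocalInvariantsCanonical`); here the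
BASE moves: for `θ : K₁ ⥲ K₂` identifying the valuation rings and `θ_L : L₁ ⥲ L₂` over `θ` (finite Galois layers), the
transport `Hⁿ(Gal(L₁/K₁), L₁ˣ) → Hⁿ(Gal(L₂/K₂), L₂ˣ)` along (`s ↦ θ_L⁻¹ s θ_L`, `u ↦ θ_L u`) (§5, Frobenioids `semiConj`)
intertwines `inv_{L₁/K₁}`, `inv_{L₂/K₂}` (§6).  Proof: `unitsAbsInfTwo` commutes with the transports — both composites
`H²(Gal(L₁/K₁), L₁ˣ) → H²(Γ_{K₂}, K̄₂ˣ)` are pulls of the same cocycle along compatible pairs attached to the two ring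
embeddings `Θ ∘ ι_{L₁}`, `ι_{L₂} ∘ θ_L : L₁ → K̄₂` over `θ`, which differ by an element of `Gal(L₁/K₁)` (normality;
`CompatiblePair.twoCocycleClass_pull_eq_of_ringHom_eq_comp`) — and file 1's `inv_{K₂} ∘ T_Θ = inv_{K₁}`.

## What is formalised (`K₁ K₂ L₁ L₂ : Type`)
* §5 `layerTransportHom`, **`layerTransport θ L₁ L₂ θL hθL n : Hⁿ(Gal(L₁/K₁), L₁ˣ) ⟶ Hⁿ(Gal(L₂/K₂), L₂ˣ)`**,
  `exists_algEquiv_embedding_eq`, `transportPair_φ_ofMul`, `layerPair_φ_ofMul`, **`unitsAbsInfTwo_layerTransport`**.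
* §6 **`layerInv_layerTransport`**: `layerInv K₂ L₂ (layerTransport θ L₁ L₂ θL hθL 2 y) = layerInv K₁ L₁ y`.

HONEST FRAMING: classical local class field theory; no statement of a Summit, of Tate's theorem or of the crux is
proved here; 0 cells / labels / tiers move.

## References
* J.-P. Serre, *Local Fields*, GTM 67 (1979), Ch. VII §5 Prop. 3, Ch. XI §1 (iv), Ch. XIII §3. [SerreLocalFields1979]
* J.-P. Serre, *Galois Cohomology* (1997), Ch. I §2.4–2.5. [SerreGaloisCohomology1997]
* J. W. S. Cassels, A. Fröhlich (eds.), *Algebraic Number Theory* (1967), Ch. VII (Tate) §1.1. [CasselsFrohlichANT1967]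
* S. Mochizuki, *The geometry of Frobenioids II* (2008), Thm. 2.4 (i). [MochizukiFrdII2008]
-/

noncomputable section

open CategoryTheory groupCohomology Function Field

namespace Literature.NumberTheory.GaloisRepresentations

namespace UnitsLayer

open DiscreteGaloisModule Literature.Algebra.Homology
open _root_.ContinuousCohomology
open Literature.AnabelianGeometry.AbsoluteAnabelian
open Literature.AnabelianGeometry.AbsoluteAnabelian.Prop121vii
open Literature.AlgebraicGeometry.Frobenioids.PadicKummer
open LocalBrauer
open scoped ValuativeRel

-- Explicit `2`-cocycle classes need `LocallyCompactSpace Γ_K`; the tree's theorem (every field) is the only source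
-- of it.  Local to this file, no override (as in `GaloisCohomologyUnitsInflationCocycle.lean`).
attribute [local instance] absoluteGaloisGroup_compactSpace

/-! ## §5. Finite layers: the transport `Hⁿ(Gal(L₁/K₁), L₁ˣ) ⟶ Hⁿ(Gal(L₂/K₂), L₂ˣ)` over `θ` -/

section Layer

variable {K₁ K₂ : Type} [Field K₁] [Field K₂] (θ : K₁ ≃+* K₂)
  (L₁ L₂ : Type) [Field L₁] [Field L₂] [Algebra K₁ L₁] [Algebra K₂ L₂]
  (θL : L₁ ≃+* L₂) (hθL : ∀ x : K₁, θL (algebraMap K₁ L₁ x) = algebraMap K₂ L₂ (θ x))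

/-- **The module component `u ↦ θ_L u : L₁ˣ → L₂ˣ`** over the group isomorphism `Gal(L₂/K₂) → Gal(L₁/K₁)`,
`s ↦ θ_L⁻¹ s θ_L` (Frobenioids `semiConj⁻¹`): a morphism `Res (L₁ˣ) ⟶ L₂ˣ` of `Gal(L₂/K₂)`-modules.
[cite: SerreLocalFields1979, Ch. XI §1 (iv)][cite: MochizukiFrdII2008, Thm 2.4 (i) p.19] -/
def layerTransportHom :
    Rep.res ((semiConj θ θL hθL).symm.toMonoidHom : (L₂ ≃ₐ[K₂] L₂) →* (L₁ ≃ₐ[K₁] L₁))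
        (Rep.ofAlgebraAutOnUnits K₁ L₁) ⟶ Rep.ofAlgebraAutOnUnits K₂ L₂ :=
  Rep.ofHom ⟨(MonoidHom.toAdditive (Units.map (θL : L₁ →* L₂))).toIntLinearMap, fun s => by
      apply LinearMap.ext
      intro a
      obtain ⟨u, rfl⟩ := (Additive.ofMul : L₁ˣ ≃ Additive L₁ˣ).surjective a
      refine Additive.toMul.injective (Units.ext ?_)
      -- `θ_L (θ_L⁻¹ (s (θ_L u))) = s (θ_L u)`
      change θL ((semiConj θ θL hθL).symm s • u : L₁ˣ) = ((s • Units.map (θL : L₁ →* L₂) u : L₂ˣ) : L₂)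
      rw [AlgEquiv.smul_units_def, AlgEquiv.smul_units_def, Units.coe_map, Units.coe_map, MonoidHom.coe_coe,
        MonoidHom.coe_coe, semiConj_symm_apply, RingEquiv.apply_symm_apply]
      rfl⟩

/-- Unfolding: `layerTransportHom` is `u ↦ θ_L u` on units. [cite: SerreLocalFields1979, Ch. XI §1 (iv)] -/
theorem layerTransportHom_hom_ofMul (u : L₁ˣ) :
    (layerTransportHom θ L₁ L₂ θL hθL).hom (Additive.ofMul u) = Additive.ofMul (Units.map (θL : L₁ →* L₂) u) := rfl

/-- **The transport `Hⁿ(Gal(L₁/K₁), L₁ˣ) ⟶ Hⁿ(Gal(L₂/K₂), L₂ˣ)` along `(θ, θ_L)`**: `Hⁿ(s ↦ θ_L⁻¹ s θ_L, u ↦ θ_L u)`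
(Serre's transport of structure, with a moving base field). [cite: SerreLocalFields1979, Ch. XI §1 (iv)]
[cite: CasselsFrohlichANT1967, Ch. VII §1.1] -/
def layerTransport (n : ℕ) :
    groupCohomology (Rep.ofAlgebraAutOnUnits K₁ L₁) n ⟶ groupCohomology (Rep.ofAlgebraAutOnUnits K₂ L₂) n :=
  groupCohomology.map ((semiConj θ θL hθL).symm.toMonoidHom : (L₂ ≃ₐ[K₂] L₂) →* (L₁ ≃ₐ[K₁] L₁))
    (layerTransportHom θ L₁ L₂ θL hθL) n

variable [FiniteDimensional K₁ L₁] [FiniteDimensional K₂ L₂]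
  (Θ : AlgebraicClosure K₁ ≃+* AlgebraicClosure K₂)
  (hΘ : ∀ x : K₁, Θ (algebraMap K₁ (AlgebraicClosure K₁) x) = algebraMap K₂ (AlgebraicClosure K₂) (θ x))

include hθL hΘ in
/-- **The two embeddings `L₁ → K̄₂` over `θ` — `Θ ∘ ι_{L₁}` and `ι_{L₂} ∘ θ_L` — differ by an element of
`Gal(L₁/K₁)`** (`L₁/K₁` normal; Mathlib `AlgHom.restrictNormal'`, with `K̄₂` a `K₁`-algebra through `θ`).
[cite: SerreLocalFields1979, Ch. VII §5 Prop. 3] -/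
theorem exists_algEquiv_embedding_eq [Normal K₁ L₁] :
    ∃ σ : L₁ ≃ₐ[K₁] L₁, ∀ x : L₁,
      embeddingToAbs K₂ L₂ (θL x) = Θ (embeddingToAbs K₁ L₁ (σ x)) := by
  letI : Algebra K₁ (AlgebraicClosure K₂) :=
    ((algebraMap K₂ (AlgebraicClosure K₂)).comp (θ : K₁ →+* K₂)).toAlgebra
  have halg : ∀ a : K₁, algebraMap K₁ (AlgebraicClosure K₂) a = algebraMap K₂ (AlgebraicClosure K₂) (θ a) :=
    fun _ => rfl
  let j₁ : L₁ →ₐ[K₁] AlgebraicClosure K₂ :=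
    { toRingHom := (Θ : AlgebraicClosure K₁ →+* AlgebraicClosure K₂).comp (embeddingToAbs K₁ L₁ : L₁ →+* AlgebraicClosure K₁)
      commutes' := fun a => by
        change Θ (embeddingToAbs K₁ L₁ (algebraMap K₁ L₁ a)) = algebraMap K₁ (AlgebraicClosure K₂) a
        rw [AlgHom.commutes, hΘ, halg] }
  let j₂ : L₁ →ₐ[K₁] AlgebraicClosure K₂ :=
    { toRingHom := (embeddingToAbs K₂ L₂ : L₂ →+* AlgebraicClosure K₂).comp (θL : L₁ →+* L₂)
      commutes' := fun a => by
        change embeddingToAbs K₂ L₂ (θL (algebraMap K₁ L₁ a)) = algebraMap K₁ (AlgebraicClosure K₂) a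
        rw [hθL, AlgHom.commutes, halg] }
  letI : Algebra L₁ (AlgebraicClosure K₂) := (j₁ : L₁ →+* AlgebraicClosure K₂).toAlgebra
  haveI : IsScalarTower K₁ L₁ (AlgebraicClosure K₂) :=
    IsScalarTower.of_algebraMap_eq fun a => (j₁.commutes a).symm
  refine ⟨j₂.restrictNormal' L₁, fun x => ?_⟩
  have h := AlgHom.restrictNormal_commutes j₂ L₁ x
  rw [Algebra.algebraMap_self, RingHom.id_apply] at h
  exact h.symm

variable [CharZero K₁] [CharZero K₂] [IsGalois K₁ L₁] [IsGalois K₂ L₂]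

omit [CharZero K₂] in
/-- Module component of the transported pair `(Γ_{K₂}, K̄₂ˣ) → (Gal(L₁/K₁), L₁ˣ)` through `Br(K₁)`:
`u ↦ Θ (ι_{L₁} u)`. [cite: SerreGaloisCohomology1997, I §2.4] -/
theorem transportPair_φ_ofMul (u : L₁ˣ) :
    ((((absUnitsPair K₁ L₁).pullback ((galConjₜ θ Θ hΘ).symm : absoluteGaloisGroup K₂ →ₜ* absoluteGaloisGroup K₁)
        (transportResHom θ Θ hΘ)).pullback (ContinuousMonoidHom.id _) (transportCoeffHom θ Θ hΘ)).φ (Additive.ofMul u)) =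
      UnitsCarrier.ofUnits (Units.map (((Θ : AlgebraicClosure K₁ →+* AlgebraicClosure K₂).comp
        (embeddingToAbs K₁ L₁ : L₁ →+* AlgebraicClosure K₁)) : L₁ →* AlgebraicClosure K₂) u) := by
  rw [CompatiblePair.pullback_φ_apply, CompatiblePair.pullback_φ_apply, absUnitsPair_φ_ofMul]
  apply unitsVal_injective K₂
  change Units.mapEquiv Θ.toMulEquiv (Units.map (embeddingToAbs K₁ L₁ : L₁ →* AlgebraicClosure K₁) u) = _
  exact Units.ext rfl

omit [CharZero K₁] [IsGalois K₁ L₁] [FiniteDimensional K₁ L₁] in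
/-- Module component of the layer pair `(Γ_{K₂}, K̄₂ˣ) → (Gal(L₁/K₁), L₁ˣ)` through `Gal(L₂/K₂)`: `u ↦ ι_{L₂} (θ_L u)`.
[cite: SerreGaloisCohomology1997, I §2.4] -/
theorem layerPair_φ_ofMul (u : L₁ˣ) :
    ((absUnitsPair K₂ L₂).compMap ((semiConj θ θL hθL).symm.toMonoidHom : (L₂ ≃ₐ[K₂] L₂) →* (L₁ ≃ₐ[K₁] L₁))
        (layerTransportHom θ L₁ L₂ θL hθL)).φ (Additive.ofMul u) =
      UnitsCarrier.ofUnits (Units.map (((embeddingToAbs K₂ L₂ : L₂ →+* AlgebraicClosure K₂).comp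
        (θL : L₁ →+* L₂)) : L₁ →* AlgebraicClosure K₂) u) := by
  rw [CompatiblePair.compMap_φ_apply]
  exact (absUnitsPair_φ_ofMul K₂ L₂ (Units.map (θL : L₁ →* L₂) u)).trans (congrArg UnitsCarrier.ofUnits (Units.ext rfl))

/-- **`unitsAbsInfTwo` commutes with the transports**: `unitsAbsInfTwo K₂ L₂ (T_{layer} y) = T_{Br} (unitsAbsInfTwo K₁ L₁ y)`
— both are pulls of the same cocycle along compatible pairs `(Γ_{K₂}, K̄₂ˣ) → (Gal(L₁/K₁), L₁ˣ)` attached to the two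
`Gal(L₁/K₁)`-conjugate embeddings `L₁ → K̄₂` over `θ`. [cite: SerreGaloisCohomology1997, I §2.4–2.5]
[cite: SerreLocalFields1979, Ch. VII §5 Prop. 3] -/
theorem unitsAbsInfTwo_layerTransport (y : groupCohomology (Rep.ofAlgebraAutOnUnits K₁ L₁) 2) :
    unitsAbsInfTwo K₂ L₂ (layerTransport θ L₁ L₂ θL hθL 2 y) = brauerTransport θ Θ hΘ (unitsAbsInfTwo K₁ L₁ y) := by
  induction y using H2_induction_on with
  | h b =>
  change unitsAbsInfTwo K₂ L₂ (groupCohomology.map _ (layerTransportHom θ L₁ L₂ θL hθL) 2 (H2π _ b)) = _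
  rw [H2π_comp_map_apply, unitsAbsInfTwo_H2π, CompatiblePair.pull_mapCocycles₂, unitsAbsInfTwo_H2π,
    brauerTransport_twoCocycleClass_eq_pullback, CompatiblePair.pullback_pull, CompatiblePair.pullback_pull]
  obtain ⟨σ, hσ⟩ := exists_algEquiv_embedding_eq θ L₁ L₂ θL hθL Θ hΘ
  exact CompatiblePair.twoCocycleClass_pull_eq_of_ringHom_eq_comp K₂
    (((absUnitsPair K₁ L₁).pullback ((galConjₜ θ Θ hΘ).symm : absoluteGaloisGroup K₂ →ₜ* absoluteGaloisGroup K₁)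
        (transportResHom θ Θ hΘ)).pullback (ContinuousMonoidHom.id _) (transportCoeffHom θ Θ hΘ))
    ((absUnitsPair K₂ L₂).compMap ((semiConj θ θL hθL).symm.toMonoidHom : (L₂ ≃ₐ[K₂] L₂) →* (L₁ ≃ₐ[K₁] L₁))
        (layerTransportHom θ L₁ L₂ θL hθL))
    (((Θ : AlgebraicClosure K₁ →+* AlgebraicClosure K₂).comp (embeddingToAbs K₁ L₁ : L₁ →+* AlgebraicClosure K₁)))
    (((embeddingToAbs K₂ L₂ : L₂ →+* AlgebraicClosure K₂).comp (θL : L₁ →+* L₂)))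
    σ (transportPair_φ_ofMul θ L₁ Θ hΘ) (layerPair_φ_ofMul θ L₁ L₂ θL hθL) hσ b

end Layer

/-! ## §6. `inv_{L₂/K₂} ∘ H²(θ) = inv_{L₁/K₁}` -/

section Main

variable {K₁ K₂ : Type} [Field K₁] [ValuativeRel K₁] [TopologicalSpace K₁] [IsNonarchimedeanLocalField K₁]
  [CharZero K₁] [Field K₂] [ValuativeRel K₂] [TopologicalSpace K₂] [IsNonarchimedeanLocalField K₂] [CharZero K₂]
  (θ : K₁ ≃+* K₂) (hO : ∀ x : K₁, x ∈ 𝒪[K₁] ↔ θ x ∈ 𝒪[K₂])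
  (L₁ L₂ : Type) [Field L₁] [Field L₂] [Algebra K₁ L₁] [Algebra K₂ L₂]
  [FiniteDimensional K₁ L₁] [FiniteDimensional K₂ L₂] [IsGalois K₁ L₁] [IsGalois K₂ L₂]
  (θL : L₁ ≃+* L₂) (hθL : ∀ x : K₁, θL (algebraMap K₁ L₁ x) = algebraMap K₂ L₂ (θ x))

include hO in
/-- **THE invariant `inv_{L/K}` of an abstract finite Galois layer of a char-0 non-archimedean local field is preserved by
transport along an isomorphism of base fields**: for `θ : K₁ ⥲ K₂` identifying the valuation rings and `θ_L : L₁ ⥲ L₂`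
over `θ`, `inv_{L₂/K₂} (H²(θ_L⁻¹ · θ_L, θ_L) y) = inv_{L₁/K₁} (y)` for every `y ∈ H²(Gal(L₁/K₁), L₁ˣ)` (Serre's transport
of structure; Tate's "`σ_w : L_w → L_{σw}` … trivially preserves the invariant map").  Proof: `layerInv = inv_K ∘ unitsAbsInfTwo`,
§5 and §4 with a lift `Θ : K̄₁ ⥲ K̄₂` of `θ` (Mathlib `IsAlgClosure.equivOfEquiv`).
[cite: SerreLocalFields1979, Ch. XI §1 (iv)][cite: CasselsFrohlichANT1967, Ch. VII §1.1][cite: MochizukiAbsAnab2004, Prop 1.2.1 (vii) p.11] -/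
theorem layerInv_layerTransport (y : groupCohomology (Rep.ofAlgebraAutOnUnits K₁ L₁) 2) :
    layerInv K₂ L₂ (layerTransport θ L₁ L₂ θL hθL 2 y) = layerInv K₁ L₁ y := by
  -- a lift `Θ : K̄₁ ⥲ K̄₂` of `θ`
  let Θ : AlgebraicClosure K₁ ≃+* AlgebraicClosure K₂ :=
    IsAlgClosure.equivOfEquiv (S := K₁) (R := K₂) (AlgebraicClosure K₁) (AlgebraicClosure K₂) θ
  have hΘ : ∀ x : K₁, Θ (algebraMap K₁ (AlgebraicClosure K₁) x) = algebraMap K₂ (AlgebraicClosure K₂) (θ x) :=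
    fun x => IsAlgClosure.equivOfEquiv_algebraMap (S := K₁) (R := K₂) (AlgebraicClosure K₁) (AlgebraicClosure K₂) θ x
  rw [layerInv_eq_brauerInvariantEquiv_unitsAbsInfTwo, layerInv_eq_brauerInvariantEquiv_unitsAbsInfTwo,
    unitsAbsInfTwo_layerTransport θ L₁ L₂ θL hθL Θ hΘ, brauerInvariantEquiv_brauerTransport θ Θ hΘ hO]

end Main

end UnitsLayer

end Literature.NumberTheory.GaloisRepresentations

end
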